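import Literature.NumberTheory.Weil1964.ArchFollandCoordinates
import HarnessLib

/-!
# The Folland cocycle of the archimedean Schrödinger factor is trivial

Topic `NumberTheory/Weil1964`; namespace `Literature.NumberTheory.Weil1964`. Proved lemmas only: **no named facts,
no records, 0 proof holes**.

**Setting** (`ArchSchrodingerFollandDictionary`, `ArchFollandCoordinates`). `F` a number field, `ι` a finite index
type, `T : Matrix ι ι 𝔸_F` an adelic Gram matrix with archimedean part `T_∞ = archMat T`, `g ∈ Sp(W_𝔸)` for the polar
form of `adelicForm T`, acting on archimedean pairs by `archAct T g (a, w) = (a', w')`; a real frame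
`e : (F ⊗ ℝ)^ι ≃L[ℝ] ℝ^σ` with Folland coordinates `archFolland T e (a, w) = (e a, follandFreq e (T_∞ w))`.  The
dictionary file proved the projective Folland covariance of the archimedean factor `A` of any `ρ_T(g)`-implementer,
`A (rhoSD e p q Φ) = follandCocycle T e g (a, w) • rhoSD e p' q' (A Φ)`, with the unimodular scalar
`follandCocycle T e g (a, w) = weilPhase T g (a, w) · e^{−iπ (e a')·q'} · e^{iπ (e a)·q}`, where
`weilPhase T g (a, w) = ψ_F(f_g(archVec a, archVec w))` is the value of the adelic character on Weil's section
`f_g(v) = ½ (B(g v, g v) − B(v, v))` (`ofSymplectic_f`).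

**Content.** That scalar is identically `1`:

* §1 `weilPhase_apply`: `weilPhase T g (a, w) = exp(iπ (τ − τ'))` with `τ = ⟨a, T_∞ w⟩_{Tr}`, `τ' = ⟨a', T_∞ w'⟩_{Tr}`
  (`piTracePairing`).  Proof: `f_g(archVec a, archVec w)` is the archimedean adele
  `⅟2 · (Σ_i a'_i (T_∞ w')_i − Σ_i a_i (T_∞ w)_i)` (`archVec_dotProduct_archVec`, `mulVec_archVec`,
  `mul_infiniteAdeleInl`), `ψ_F(y, 0) = 𝐞(−Tr_∞ y)` (Tate's sign, `adeleAddChar_infiniteAdeleInl`) and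
  `Tr_∞(⅟2 · y) = ½ Tr_∞ y` (`infiniteAdeleTrace_invOf_two_mul`).
* `follandCocycle_eq_one`: since `(e u) · follandFreq e w = −⟨u, w⟩_{Tr}` (`follandFreq_dotProduct_apply`), the two
  Folland half-phases are `e^{iπτ'} · e^{−iπτ}` and cancel Weil's phase exactly; hence `archCocycle_eq_one` and
  **`arch_covariant_rhoSD_exact`**: `A (rhoSD e p q Φ) = rhoSD e (archPhaseMap T e hT g (p, q)).1 (…).2 (A Φ)` for ALL
  `(p, q)` — `arch_covariant_rhoSD_all` with no scalar, i.e. the archimedean factor is EXACTLY Heisenberg-covariant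
  over the affine phase-space map `archPhaseMap T e hT g` (the hypothesis shape of `SegalBargmann.IsPhaseCovariantSD`
  /
  `IsRhoCovariantS`); conversely `arch_implements_of_covariant_rhoSD(_clm)`: an exactly `rhoSD`-covariant `A`
  implements `g` on `archModTrans` up to `weilPhase` (the (w2)-currency of the mc-weil-2 lane).

Dictionary with print: Weil [Weil1964] n° 5 lifts `σ ∈ Sp(W)` to the pseudosymplectic `(σ, f_σ)` with
`f_σ(v) = ½(F(σv, σv) − F(v, v))` (in additive notation for the second-degree character), and the Schrödinger model
transforms under `(σ, f_σ)` with exactly this character value (n° 11–13); Folland [Folland1989] Prop. (1.43) writes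
the
same covariance as `ρ(p, q) ↦ ρ(S(p, q))` up to the metaplectic phase, which for the Heisenberg translates themselves
is
trivial ((1.25), (4.6)).  The present file is the bookkeeping that the tree's two half-conventions (`ψ_∞ = e^{−2πi
Tr}`,
Folland's `e^{−iπ p·q}` multiplier `rhoMul`) match with no residual sign.

## Mathlib / tree

Mathlib: `NumberField.InfiniteAdeleRing.ringEquiv_mixedSpace`, `InfiniteAdeleRing.mixedEmbedding_eq_algebraMap_comp`,
`mixedEmbedding_apply_isReal/isComplex`, `Real.fourierChar` (`𝐞`), `Complex.exp_add`.
Tree: `archVec` (`archVec_apply_fst/snd`), `archMat`, `mulVec_archVec`, `archAct`, `apply_archVec_pair`, `weilPhase`,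
`follandCocycle`, `follandFreq_dotProduct_apply`, `piTracePairing_apply`, `mixedTrace_ringEquiv_mixedSpace`,
`infiniteAdeleInl` (`infiniteAdeleInl_apply`), `adeleAddChar_infiniteAdeleInl`, `invertibleTwoAdeleRing`,
`ofSymplectic_f`, `polar_apply`, `adelicForm_apply`, `archFolland_bijective`, `archCocycle_archFolland`,
`arch_covariant_rhoSD_all`.

## References
* [Folland1989] G. B. Folland, *Harmonic Analysis in Phase Space*, Princeton UP (1989), Prop. (1.43), (1.25), Prop. (4.6).
* [Weil1964] A. Weil, *Sur certains groupes d'opérateurs unitaires*, Acta Math. 111 (1964), n° 5, n° 11–13.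
* [CasselsFrohlichANT1967] J. W. S. Cassels, A. Fröhlich (eds.), *Algebraic Number Theory* (1967), Ch. XV (Tate), §2.2.

## Provenance

Written under the LEAN-IN-TREE rule (2026-08-18) for the pub-hodgecm formalisation cell (reserve seat pv08 gen 24;
the (w2)-currency bridge named LEAF C by the mc-weil-2 lane, 2026-08-19); KERNEL only — nothing here is a claim of
the sources beyond the cited dictionary; all statements are proved.
-/

set_option autoImplicit false

noncomputable section

open scoped Matrix SchwartzMap TensorProduct Real Classical FourierTransform
open Complex NumberField NumberField.InfinitePlace NumberField.mixedEmbedding IsDedekindDomain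
open Literature.NumberTheory.Automorphic
open Literature.RepresentationTheory.HeisenbergGroup Literature.Analysis.SegalBargmann

namespace Literature.NumberTheory.Weil1964

variable {F : Type} [Field F] [NumberField F] {ι : Type} [Fintype ι] [DecidableEq ι]

/-! ## §1 The Folland cocycle is trivial (every `g ∈ Sp(W_𝔸)`, every frame `e`) -/

section Cocycle

/-- `𝐞 s = exp(2πi s)` as a complex number (Mathlib `Real.fourierChar`, by `rfl`). [folklore] -/
private theorem fourierChar_coe'' (s : ℝ) : ((𝐞 s : Circle) : ℂ) = cexp (((2 * π * s : ℝ) : ℂ) * I) := rfl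

omit [Fintype ι] [DecidableEq ι] in
/-- An archimedean vector is, coordinatewise, the inclusion `K_∞ → 𝔸_K` of its mixed-space value. [folklore] -/
theorem archVec_apply_eq_infiniteAdeleInl (a : ι → mixedSpace F) (i : ι) :
    archVec F ι a i = infiniteAdeleInl F ((InfiniteAdeleRing.ringEquiv_mixedSpace F).symm (a i)) := by
  rw [infiniteAdeleInl_apply]
  exact Prod.ext (archVec_apply_fst a i) (archVec_apply_snd a i)

omit [DecidableEq ι] in
/-- **The adelic dot product of two archimedean vectors** is the archimedean adele `Σ_i a_i b_i ∈ K_∞ ⊂ 𝔸_K`.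
[folklore] -/
theorem archVec_dotProduct_archVec (a b : ι → mixedSpace F) :
    archVec F ι a ⬝ᵥ archVec F ι b =
      infiniteAdeleInl F ((InfiniteAdeleRing.ringEquiv_mixedSpace F).symm (∑ i, a i * b i)) := by
  rw [dotProduct, map_sum (InfiniteAdeleRing.ringEquiv_mixedSpace F).symm, map_sum (infiniteAdeleInl F)]
  refine Finset.sum_congr rfl fun i _ => ?_
  rw [archVec_apply_eq_infiniteAdeleInl, archVec_apply_eq_infiniteAdeleInl, ← map_mul, ← map_mul]

omit [Fintype ι] [DecidableEq ι] in
/-- `u · (y, 0) = (u_∞ y, 0)` in `𝔸_K = K_∞ × 𝔸_{K,f}`. [folklore] -/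
theorem mul_infiniteAdeleInl (u : AdeleRing (𝓞 F) F) (y : InfiniteAdeleRing F) :
    u * infiniteAdeleInl F y = infiniteAdeleInl F (u.1 * y) := by
  rw [infiniteAdeleInl_apply, infiniteAdeleInl_apply]
  exact Prod.ext rfl (mul_zero _)

omit [NumberField F] [Fintype ι] [DecidableEq ι] in
/-- `σ(½) · x = ½ • x` in the mixed space. [folklore] -/
theorem mixedEmbedding_inv_two_mul (x : mixedSpace F) : mixedEmbedding F (2⁻¹ : F) * x = (2⁻¹ : ℝ) • x := by
  refine Prod.ext (funext fun v => ?_) (funext fun w => ?_)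
  · rw [Prod.fst_mul, Pi.mul_apply, mixedEmbedding_apply_isReal, map_inv₀, map_ofNat, Prod.smul_fst,
      Pi.smul_apply, smul_eq_mul]
  · rw [Prod.snd_mul, Pi.mul_apply, mixedEmbedding_apply_isComplex, map_inv₀, map_ofNat, Prod.smul_snd,
      Pi.smul_apply, Complex.real_smul, Complex.ofReal_inv, Complex.ofReal_ofNat]

omit [Fintype ι] [DecidableEq ι] in
/-- `Tr_∞(½ y) = ½ Tr_∞(y)` for the adelic half `⅟2 = 2⁻¹ ⊗ 1`. [folklore] -/
theorem infiniteAdeleTrace_invOf_two_mul (y : InfiniteAdeleRing F) :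
    infiniteAdeleTrace F ((⅟(2 : AdeleRing (𝓞 F) F)).1 * y) = 2⁻¹ * infiniteAdeleTrace F y := by
  rw [← mixedTrace_ringEquiv_mixedSpace, ← mixedTrace_ringEquiv_mixedSpace, map_mul]
  have h2 : InfiniteAdeleRing.ringEquiv_mixedSpace F (⅟(2 : AdeleRing (𝓞 F) F)).1 =
      mixedEmbedding F (2⁻¹ : F) := by
    rw [InfiniteAdeleRing.mixedEmbedding_eq_algebraMap_comp]
    rfl
  rw [h2, mixedEmbedding_inv_two_mul, map_smul, smul_eq_mul]

variable (T : Matrix ι ι (AdeleRing (𝓞 F) F))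

/-- **Weil's phase at an archimedean pair, explicitly**: `ψ_F(f_g(a, w)) = exp(iπ(τ − τ'))` with
`τ = ⟨a, T_∞ w⟩_{Tr}`, `τ' = ⟨a', T_∞ w'⟩_{Tr}`, `(a', w') = archAct g (a, w)` — since `f_g(v) = ½(B(gv,gv) − B(v,v))`
is the archimedean adele `½(Σ a'_i (T_∞ w')_i − Σ a_i (T_∞ w)_i)` and `ψ_∞ = e^{−2πi Tr_∞}` (Tate).
(Tate's `ψ_∞`: Cassels–Fröhlich Ch. XV §2.2.) [cite: Weil1964, n° 5] -/
theorem weilPhase_apply (g : symplecticGroup (polar (adelicForm F ι T))) (a w : ι → mixedSpace F) :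
    weilPhase T g (a, w) =
      cexp (((π * (piTracePairing F ι a (archMat F ι T *ᵥ w) -
        piTracePairing F ι (archAct T g (a, w)).1 (archMat F ι T *ᵥ (archAct T g (a, w)).2)) : ℝ) : ℂ) * I) := by
  rw [weilPhase]
  simp only [ofSymplectic_f, polar_apply, adelicForm_apply]
  rw [apply_archVec_pair T g a w]
  simp only []
  rw [mulVec_archVec, mulVec_archVec, archVec_dotProduct_archVec, archVec_dotProduct_archVec,
    ← map_sub (infiniteAdeleInl F), mul_infiniteAdeleInl, adeleAddChar_infiniteAdeleInl,
    infiniteAdeleTrace_invOf_two_mul, map_sub (infiniteAdeleTrace F), ← mixedTrace_ringEquiv_mixedSpace,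
    ← mixedTrace_ringEquiv_mixedSpace, RingEquiv.apply_symm_apply, RingEquiv.apply_symm_apply,
    map_sum (mixedTrace F), map_sum (mixedTrace F), ← piTracePairing_apply, ← piTracePairing_apply,
    fourierChar_coe'']
  congr 1
  push_cast
  ring

omit [DecidableEq ι] in
/-- `(e u) · follandFreq e w' = −⟨u, w'⟩_{Tr}`. [folklore] -/
theorem apply_dotProduct_follandFreq {σ : Type*} [Fintype σ] (e : (ι → mixedSpace F) ≃L[ℝ] (σ → ℝ))
    (u w' : ι → mixedSpace F) : e u ⬝ᵥ follandFreq F ι e w' = -(piTracePairing F ι u w') := by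
  rw [dotProduct_comm]
  exact follandFreq_dotProduct_apply e w' u

/-- **The Folland cocycle is identically `1`**: Weil's phase `e^{iπ(τ−τ')}` cancels the two Folland
half-phases `e^{iπτ'} · e^{−iπτ}` of `archModTrans_eq_smul_rhoSD` exactly (`(e a)·q = −τ`). Hence the archimedean
factor of a `ρ_T(g)`-implementer is EXACTLY `rhoSD`-covariant over `archPhaseMap`, with no scalar.
(Weil1964 n° 5.) [cite: Folland1989, Prop. (1.43)] -/
theorem follandCocycle_eq_one {σ : Type*} [Fintype σ] (e : (ι → mixedSpace F) ≃L[ℝ] (σ → ℝ))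
    (g : symplecticGroup (polar (adelicForm F ι T))) (aw : (ι → mixedSpace F) × (ι → mixedSpace F)) :
    follandCocycle T e g aw = 1 := by
  obtain ⟨a, w⟩ := aw
  rw [follandCocycle, weilPhase_apply, ← Complex.exp_add, ← Complex.exp_add, apply_dotProduct_follandFreq,
    apply_dotProduct_follandFreq]
  conv_rhs => rw [← Complex.exp_zero]
  congr 1
  push_cast
  ring

/-- Hence `archCocycle ≡ 1` as well. [cite: Folland1989, Prop. (1.43)] -/
theorem archCocycle_eq_one {σ : Type*} [Fintype σ] (e : (ι → mixedSpace F) ≃L[ℝ] (σ → ℝ))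
    (hT : IsUnit (archMat F ι T)) (g : symplecticGroup (polar (adelicForm F ι T))) (pq : (σ → ℝ) × (σ → ℝ)) :
    archCocycle T e hT g pq = 1 := by
  obtain ⟨aw, rfl⟩ := (archFolland_bijective T e hT).2 pq
  rw [archCocycle_archFolland]
  exact follandCocycle_eq_one T e g aw

/-- **Exact Folland covariance of the archimedean factor, for ALL `(p, q)`**: `arch_covariant_rhoSD_all` with the
cocycle gone — the hypothesis shape of `SegalBargmann.IsPhaseCovariantSD` / `IsRhoCovariantS` over the phase-space
map `archPhaseMap T e hT g`. [cite: Folland1989, Prop. (1.43)] -/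
theorem arch_covariant_rhoSD_exact {σ : Type*} [Fintype σ] (e : (ι → mixedSpace F) ≃L[ℝ] (σ → ℝ))
    (hT : IsUnit (archMat F ι T)) (g : symplecticGroup (polar (adelicForm F ι T)))
    (M : piSchwartzBruhat F ι ≃ₗ[ℂ] piSchwartzBruhat F ι)
    (hM : Implements (adelicSchrodinger F ι T) (ofSymplectic (polar (adelicForm F ι T)) g) M)
    (A : 𝓢((ι → mixedSpace F), ℂ) →ₗ[ℂ] 𝓢((ι → mixedSpace F), ℂ)) (Mf : FinSB F ι →ₗ[ℂ] FinSB F ι)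
    (hAM : ∀ (Φ : 𝓢((ι → mixedSpace F), ℂ)) (f : FinSB F ι),
      M (piSchwartzBruhatEquiv F ι (Φ ⊗ₜ f)) = piSchwartzBruhatEquiv F ι (A Φ ⊗ₜ Mf f))
    {f₀ : FinSB F ι} (hf₀ : Mf f₀ ≠ 0) (p q : σ → ℝ) (Φ : 𝓢((ι → mixedSpace F), ℂ)) :
    A (rhoSD e p q Φ) = rhoSD e (archPhaseMap T e hT g (p, q)).1 (archPhaseMap T e hT g (p, q)).2 (A Φ) := by
  have h := arch_covariant_rhoSD_all T e hT g M hM A Mf hAM hf₀ p q Φ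
  rwa [archCocycle_eq_one, one_smul] at h

/-- **The converse reading, in (w2) currency**: an operator `A` that is EXACTLY `rhoSD`-covariant over
`archPhaseMap T e hT g` implements `g` on the archimedean modulated translations up to Weil's phase:
`A ∘ archModTrans T a w = weilPhase T g (a, w) • archModTrans T a' w' ∘ A`, `(a', w') = archAct g (a, w)` — the lemma
`arch_covariant_rhoSD_exact` read backwards through `archModTrans_eq_smul_rhoSD` (`e^{−iπ p·q} = e^{iπτ}`) and
`weilPhase_apply`. [cite: Folland1989, Prop. (1.43)] -/
theorem arch_implements_of_covariant_rhoSD {σ : Type*} [Fintype σ] (e : (ι → mixedSpace F) ≃L[ℝ] (σ → ℝ))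
    (hT : IsUnit (archMat F ι T)) (g : symplecticGroup (polar (adelicForm F ι T)))
    (A : 𝓢((ι → mixedSpace F), ℂ) →ₗ[ℂ] 𝓢((ι → mixedSpace F), ℂ))
    (hA : ∀ (p q : σ → ℝ) (Φ : 𝓢((ι → mixedSpace F), ℂ)),
      A (rhoSD e p q Φ) = rhoSD e (archPhaseMap T e hT g (p, q)).1 (archPhaseMap T e hT g (p, q)).2 (A Φ))
    (a w : ι → mixedSpace F) (Φ : 𝓢((ι → mixedSpace F), ℂ)) :
    A (archModTrans F ι T a w Φ) =
      weilPhase T g (a, w) • archModTrans F ι T (archAct T g (a, w)).1 (archAct T g (a, w)).2 (A Φ) := by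
  rw [archModTrans_eq_smul_rhoSD (T := T) (e := e) (a := a) (w := w) (Φ := Φ), map_smul, hA,
    show ((e a, follandFreq F ι e (archMat F ι T *ᵥ w)) : (σ → ℝ) × (σ → ℝ)) = archFolland T e (a, w) from rfl,
    archPhaseMap_archFolland, archFolland_fst, archFolland_snd, archModTrans_eq_smul_rhoSD (T := T) (e := e) (Φ := A Φ), smul_smul]
  congr 1
  rw [weilPhase_apply, apply_dotProduct_follandFreq, apply_dotProduct_follandFreq, ← Complex.exp_add]
  congr 1
  push_cast
  ring

/-- `arch_implements_of_covariant_rhoSD` for a continuous linear `A`. [cite: Folland1989, Prop. (1.43)] -/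
theorem arch_implements_of_covariant_rhoSD_clm {σ : Type*} [Fintype σ] (e : (ι → mixedSpace F) ≃L[ℝ] (σ → ℝ))
    (hT : IsUnit (archMat F ι T)) (g : symplecticGroup (polar (adelicForm F ι T)))
    (A : 𝓢((ι → mixedSpace F), ℂ) →L[ℂ] 𝓢((ι → mixedSpace F), ℂ))
    (hA : ∀ (p q : σ → ℝ) (Φ : 𝓢((ι → mixedSpace F), ℂ)),
      A (rhoSD e p q Φ) = rhoSD e (archPhaseMap T e hT g (p, q)).1 (archPhaseMap T e hT g (p, q)).2 (A Φ))
    (a w : ι → mixedSpace F) (Φ : 𝓢((ι → mixedSpace F), ℂ)) :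
    A (archModTrans F ι T a w Φ) =
      weilPhase T g (a, w) • archModTrans F ι T (archAct T g (a, w)).1 (archAct T g (a, w)).2 (A Φ) :=
  arch_implements_of_covariant_rhoSD T e hT g (A : 𝓢((ι → mixedSpace F), ℂ) →ₗ[ℂ] 𝓢((ι → mixedSpace F), ℂ)) hA a w Φ

end Cocycle

end Literature.NumberTheory.Weil1964

end
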